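import Summits.ABC.IUTFork.Conditional.AbcExpOfCor312SlackContent
import Literature.IUT.LogVolume.Corollary22OfThm110With
import Literature.NumberTheory.DiophantineGeometry.GenEllThm21With
import Literature.NumberTheory.DiophantineGeometry.GenEllThm21PrimesHolds
import HarnessLib

/-!
# R-H ROUND 2 EXPONENT PROGRAMME, piece F4½ — THE NAMED ENDS (EXP-SPEC v0.1 §1/§7, rh-lead g2 R18 (3)(b) / R19): the μ-slack θ-cut door of
# p481829 composed BY NAME with F3/F4 (`Cor22.Thm110LegendreWith`, `Cor22.abcCompactlyBoundedWith_two_of_thm110LegendreWith`) and F1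
# (`GenEll.abcExpOn_farFromCusps_of_abcCompactlyBoundedWith`, `GenEll.abcExp_of_abcCompactlyBoundedWith`)

PROOF-ONLY sequel (no `def`, no new `Prop`, no instance, no notation; nothing re-typed) of `Conditional/AbcExpOfCor312SlackContent.lean` (abc-iut-rh2-q2-cond
gen 3, p481829) by the same seat. Every theorem is ONE λ-term: p481829 §3 `thm110LegendreWith_of_cor312Slack_mu_content_hregC` (whose conclusion IS
`Cor22.Thm110LegendreWith (1/μ₀)` by `δ`-unfolding of abc-iut-rh2-exp-iut's `Cor22.DisplayWith` / `Cor22.Thm110LegendreWith`, p483174) followed by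
abc-iut-rh2-exp-iut's F3/F4 ends (C) p485398 `Cor22.abcCompactlyBoundedWith_two_of_thm110LegendreWith(_one_div)`,
`Cor22.abcExpOn_farFromCusps_of_thm110LegendreWith(_one_div)`, `Cor22.abcExp_of_thm110LegendreWith(_one_div)` ([IUTchIV] Cor. 2.2 ⟹ Cor. 2.3 bookkeeping
with the coefficient `Λ` carried — its (P4) ⟹ (P6) and (∗^{j-inv}) inputs DISCHARGED there as in the record chain — composed there with abc-iut-rh-typ-7's F1
dictionary p482093), consumed BY NAME.
HYPOTHESES (all three ONLY on the content locus «`6·(1 + 20·d_mod/l)·(log-diff + log-cond) + 120·d*_mod·l < log q^{∤{2,l}}(λ)`», `0 < μ₀ ≤ 1`):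
[NUMΣ-C] `T.negAbsLogQ ≤ T.negLogTheta + ε P l T` (p476943 VERBATIM) · [MU-C] `OffSigmaTolerance (1 − μ₀) (SigmaMass.tol P l) T (ε P l T)` · [CONE-C] `hregC`
(abc-iut-C-cert-1 p460293 VERBATIM). CONCLUSIONS (R19's three currencies):
* `thm110LegendreWith_of_cor312Slack_mu_content_hregC'` — `Cor22.Thm110LegendreWith (1/μ₀)` BY NAME (p481829 §3 retyped, `exact`);
* `abcCompactlyBoundedWith_two_of_cor312Slack_mu_content_hregC` — [GenEll] Thm. 2.1 (ii)_Λ at `Σ = {2}`: `GenEll.ABCCompactlyBoundedWith {2} (1/μ₀)`;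
* **`ABCExpOn_farFromCusps_of_cor312Slack_mu_content_hregC`** — R19 shape (a), TRANSFER-FREE: for every `0 < ρ ≤ 1/2`, abc with exponent `(1/μ₀)·(1+ε)` ON the
  triples whose point `λ = a/c` is `ρ`-far from the cusps at `∞` and `2` (`GenEll.ABCWithExponentOn {P | P.FarFromCusps {2} ρ} (1/μ₀)`; F1 §4, no Belyi map);
* **`ABCExp_of_cor312Slack_mu_content_hregC`** — R19 shape (b): `GenEll.ABCWithExponent (1/μ₀)` for ALL triples UNDER THE NAMED HYPOTHESIS
  `(hGenEllΛ : GenEll.GenEll_thm21_primesWith (1/μ₀))` — «NOT in print; NOT in reach of the printed Belyi mechanism at this Λ (exponent rigidity,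
  `GenEll.belyi_slope_not_pos`, R19); open» — never to be read as «discharged when F2 lands»; at `μ₀ = 1` it IS the tree's PROVED `GenEll_thm21_primes`
  (`genEll_thm21_primesWith_one_iff`), and then p481829 §4 / p476943 give `ABC` itself.
HONEST FRAMING: CONDITIONAL; «these abc-type sentences follow from the hypotheses AS TYPED», nothing more; whether genuine data supply `μ(T) ≥ μ₀` on the
content locus is OPEN (Q3 / round 3); for a FREE `ε` the EMPTY-certificate band of rh2-ref-3 (D) applies verbatim ([NUMΣ-C] with `ε := T.gap` is free and
[MU-C] then reads `μ₀·T.gap ≤ Tol(P,l)`, inhabited on part of the content locus iff `μ₀ < 1/4`); nothing here asserts that abc is proved or refuted, or that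
[IUTchIII] Cor. 3.12 / [IUTchIV] Thm. 1.10 holds or fails at any datum; no side taken on any author; typed ≠ proved; instantiated ≠ endorsed.
[cite: Mochizuki2012, IUTchIV Thm. 1.10 pp. 22–31; Cor. 2.2 (ii)–(iii) pp. 41–48; Cor. 2.3 pp. 54–55] [cite: Mochizuki2012, IUTchIII Cor. 3.12 p. 174]
[cite: MochizukiGenEll2010, Thm 2.1 p.11] [claim: Mochizuki2012, status: disputed]
-/

noncomputable section

namespace Summit.ABC.IUTFork.Conditional.Cor312Slack

open Literature.IUT.LogVolume Literature.IUT.HodgeTheaters Literature.NumberTheory.DiophantineGeometry.GenEll Summit.ABC.ABC.Theorems NumberField IsDedekindDomain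

/-! ## §1 F4½ §3 retyped BY NAME -/

/-- **F4½ §3 BY NAME: `Cor22.Thm110LegendreWith (1/μ₀)`** from [NUMΣ-C] · [MU-C] · [CONE-C] on the content locus (`0 < μ₀ ≤ 1`) — p481829
`thm110LegendreWith_of_cor312Slack_mu_content_hregC`, whose spelled-out conclusion is abc-iut-rh2-exp-iut's `Cor22.Thm110LegendreWith (1/μ₀)` by definitional
unfolding. CONDITIONAL; no side taken. [cite: Mochizuki2012, IUTchIV Thm. 1.10 pp. 22–31; Cor. 2.2 (ii) p. 46 l. 1] [claim: Mochizuki2012, status: disputed] -/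
theorem thm110LegendreWith_of_cor312Slack_mu_content_hregC' (μ₀ : ℝ) (hμ₀ : 0 < μ₀) (hμ₁ : μ₀ ≤ 1)
    (ε : ∀ (P : NFPoint) (l : ℕ), Cor22.ThetaVolumeDatumAt P l → ℝ)
    (h312C : ∀ P : NFPoint, P ∈ UP → ∀ l : ℕ, l.Prime → 5 ≤ l →
      Cor22.AdmitsCore P → Cor22.CondP2 P l → Cor22.CondP5 P l → Cor22.CondP6 P l →
      6 * ((1 + 20 * (Cor22.dmod P : ℝ) / l) * (P.logDiff + Cor22.logCondAvoid P {2, l}))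
          + 120 * (2 ^ 12 * 3 ^ 3 * 5 * (Cor22.dmod P : ℝ) * l) < Cor22.logQAvoid P {2, l} →
      ∀ T : Cor22.ThetaVolumeDatumAt P l, T.negAbsLogQ ≤ T.negLogTheta + ε P l T)
    (hMuC : ∀ P : NFPoint, P ∈ UP → ∀ l : ℕ, l.Prime → 5 ≤ l →
      Cor22.AdmitsCore P → Cor22.CondP2 P l → Cor22.CondP5 P l → Cor22.CondP6 P l →
      6 * ((1 + 20 * (Cor22.dmod P : ℝ) / l) * (P.logDiff + Cor22.logCondAvoid P {2, l}))
          + 120 * (2 ^ 12 * 3 ^ 3 * 5 * (Cor22.dmod P : ℝ) * l) < Cor22.logQAvoid P {2, l} →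
      ∀ T : Cor22.ThetaVolumeDatumAt P l, Repair.RH.OffSigma.OffSigmaTolerance (1 - μ₀) (SigmaMass.tol P l) T (ε P l T))
    (hregC : ∀ P : NFPoint, P ∈ UP → ∀ l : ℕ, l.Prime → 5 ≤ l →
      Cor22.AdmitsCore P → Cor22.CondP2 P l → Cor22.CondP5 P l → Cor22.CondP6 P l →
      6 * ((1 + 20 * (Cor22.dmod P : ℝ) / l) * (P.logDiff + Cor22.logCondAvoid P {2, l}))
          + 120 * (2 ^ 12 * 3 ^ 3 * 5 * (Cor22.dmod P : ℝ) * l) < Cor22.logQAvoid P {2, l} →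
      ∀ T : Cor22.ThetaVolumeDatumAt P l,
        (letI := T.instFieldF; letI := T.instNumberFieldF; letI := T.instAlgebraF; letI := T.instFieldK
         letI := T.instNumberFieldK; letI := T.instAlgebraK; letI := T.instFieldFbar; letI := T.instAlgebraFbar
         letI := T.instAlgebraKFbar; letI := T.instIsElliptic
         ¬ (∀ p ∈ T.I.supportPrimes, ∀ v w : placesOver (fieldOfModuli T.E) p,
            (Summit.ABC.IUTFork.DHData.ofInput T.I).logQloc p v = (Summit.ABC.IUTFork.DHData.ofInput T.I).logQloc p w)) →
        T.HullEstimateOf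
          (((l : ℝ) + 1) / 4 *
            ((1 + 12 * (Cor22.dmod P : ℝ) / l) * (P.logDiff + Cor22.logCondAvoid P {2, l})
              + 2 * Real.log l + 52
              + 20 / 3 * Real.log (((2 ^ 12 * 3 ^ 3 * 5 * Cor22.dmod P : ℕ) : ℝ) * (l : ℝ))
                * (Nat.primeCounting (2 ^ 12 * 3 ^ 3 * 5 * Cor22.dmod P * l) : ℝ)))) :
    Cor22.Thm110LegendreWith (1 / μ₀) :=
  thm110LegendreWith_of_cor312Slack_mu_content_hregC μ₀ hμ₀ hμ₁ ε h312C hMuC hregC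

/-! ## §2 The Λ-generic pointwise door (p481829 §1) carried to [GenEll] Thm. 2.1 (ii)_Λ at `Σ = {2}` and to the far-from-cusps families -/

/-- **(ii)_Λ at `Σ = {2}` FROM THE DILATED DISPLAY ON THE CONTENT LOCUS** (`Λ ≥ 1`): the caller's «`DisplayWith P l η_prm Λ`» at every admissible `(λ, l)`
(`l ≠ 5`) on the content locus [hdispC — ASSUMPTION LABEL] ⟹ `Cor22.Thm110LegendreWith Λ` (p481829 §1) ⟹ `GenEll.ABCCompactlyBoundedWith {2} Λ`
(abc-iut-rh2-exp-iut's [IUTchIV] Cor. 2.2 ⟹ Cor. 2.3 bookkeeping with the coefficient carried, `Cor22.abcCompactlyBoundedWith_two_of_thm110LegendreWith`).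
CONDITIONAL on `hdispC`; no side taken. [cite: Mochizuki2012, IUTchIV Cor. 2.2–2.3 pp. 41–55] [claim: Mochizuki2012, status: disputed] -/
theorem abcCompactlyBoundedWith_two_of_displayWith_content (Λ : ℝ) (hΛ : 1 ≤ Λ)
    (hdispC : ∀ η : ℝ, IsEtaPrm η → ∀ P : NFPoint, P ∈ UP → ∀ l : ℕ, l.Prime → 5 ≤ l → l ≠ 5 →
      Cor22.AdmitsCore P → Cor22.CondP2 P l → Cor22.CondP5 P l → Cor22.CondP6 P l →
      6 * ((1 + 20 * (Cor22.dmod P : ℝ) / l) * (P.logDiff + Cor22.logCondAvoid P {2, l}))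
          + 120 * (2 ^ 12 * 3 ^ 3 * 5 * (Cor22.dmod P : ℝ) * l) < Cor22.logQAvoid P {2, l} →
      Cor22.DisplayWith P l η Λ) :
    ABCCompactlyBoundedWith {2} Λ :=
  Cor22.abcCompactlyBoundedWith_two_of_thm110LegendreWith hΛ (thm110LegendreWith_of_displayWith_content Λ hΛ hdispC)

/-- **abc WITH EXPONENT `Λ` ON EVERY FAR-FROM-CUSPS FAMILY from the dilated display on the content locus** (`Λ ≥ 1`; R19 shape (a), TRANSFER-FREE): for
every `0 < ρ ≤ 1/2`, `GenEll.ABCWithExponentOn {P | P.FarFromCusps {2} ρ} Λ` (abc-iut-rh-typ-7's F1 §4 `abcExpOn_farFromCusps_of_abcCompactlyBoundedWith`,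
no Belyi map). CONDITIONAL on `hdispC`; no side taken. [cite: Mochizuki2012, IUTchIV Cor. 2.2–2.3 pp. 41–55] [cite: MochizukiGenEll2010, Thm 2.1 p.12]
[claim: Mochizuki2012, status: disputed] -/
theorem ABCExpOn_farFromCusps_of_displayWith_content (Λ : ℝ) (hΛ : 1 ≤ Λ)
    (hdispC : ∀ η : ℝ, IsEtaPrm η → ∀ P : NFPoint, P ∈ UP → ∀ l : ℕ, l.Prime → 5 ≤ l → l ≠ 5 →
      Cor22.AdmitsCore P → Cor22.CondP2 P l → Cor22.CondP5 P l → Cor22.CondP6 P l →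
      6 * ((1 + 20 * (Cor22.dmod P : ℝ) / l) * (P.logDiff + Cor22.logCondAvoid P {2, l}))
          + 120 * (2 ^ 12 * 3 ^ 3 * 5 * (Cor22.dmod P : ℝ) * l) < Cor22.logQAvoid P {2, l} →
      Cor22.DisplayWith P l η Λ) {ρ : ℝ} (h0 : 0 < ρ) (h2 : ρ ≤ 1 / 2) :
    ABCWithExponentOn {P : NFPoint | P.FarFromCusps {2} ρ} Λ :=
  Cor22.abcExpOn_farFromCusps_of_thm110LegendreWith hΛ (thm110LegendreWith_of_displayWith_content Λ hΛ hdispC) h0 h2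

/-! ## §3 The μ-slack door (p481829 §3) carried to the three currencies of R19 -/

/-- **[GenEll] Thm. 2.1 (ii)_Λ at `Σ = {2}`, `Λ = 1/μ₀`, FROM [NUMΣ-C] · [MU-C] · [CONE-C]** (`0 < μ₀ ≤ 1`): the weakened Corollary with slack `ε` within the
relative tolerance `(1−μ₀)·T.gap + Tol(P,l)` and `hregC`, all three ONLY on the content locus, give `GenEll.ABCCompactlyBoundedWith {2} (1/μ₀)` — F4½ §3 then
abc-iut-rh2-exp-iut's `Cor22.abcCompactlyBoundedWith_two_of_thm110LegendreWith`. CONDITIONAL; nothing asserted about the hypotheses; no side taken.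
[cite: Mochizuki2012, IUTchIV Thm. 1.10 pp. 22–31; Cor. 2.2–2.3 pp. 41–55] [cite: Mochizuki2012, IUTchIII Cor. 3.12 p. 174] [claim: Mochizuki2012, status: disputed] -/
theorem abcCompactlyBoundedWith_two_of_cor312Slack_mu_content_hregC (μ₀ : ℝ) (hμ₀ : 0 < μ₀) (hμ₁ : μ₀ ≤ 1)
    (ε : ∀ (P : NFPoint) (l : ℕ), Cor22.ThetaVolumeDatumAt P l → ℝ)
    (h312C : ∀ P : NFPoint, P ∈ UP → ∀ l : ℕ, l.Prime → 5 ≤ l →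
      Cor22.AdmitsCore P → Cor22.CondP2 P l → Cor22.CondP5 P l → Cor22.CondP6 P l →
      6 * ((1 + 20 * (Cor22.dmod P : ℝ) / l) * (P.logDiff + Cor22.logCondAvoid P {2, l}))
          + 120 * (2 ^ 12 * 3 ^ 3 * 5 * (Cor22.dmod P : ℝ) * l) < Cor22.logQAvoid P {2, l} →
      ∀ T : Cor22.ThetaVolumeDatumAt P l, T.negAbsLogQ ≤ T.negLogTheta + ε P l T)
    (hMuC : ∀ P : NFPoint, P ∈ UP → ∀ l : ℕ, l.Prime → 5 ≤ l →
      Cor22.AdmitsCore P → Cor22.CondP2 P l → Cor22.CondP5 P l → Cor22.CondP6 P l →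
      6 * ((1 + 20 * (Cor22.dmod P : ℝ) / l) * (P.logDiff + Cor22.logCondAvoid P {2, l}))
          + 120 * (2 ^ 12 * 3 ^ 3 * 5 * (Cor22.dmod P : ℝ) * l) < Cor22.logQAvoid P {2, l} →
      ∀ T : Cor22.ThetaVolumeDatumAt P l, Repair.RH.OffSigma.OffSigmaTolerance (1 - μ₀) (SigmaMass.tol P l) T (ε P l T))
    (hregC : ∀ P : NFPoint, P ∈ UP → ∀ l : ℕ, l.Prime → 5 ≤ l →
      Cor22.AdmitsCore P → Cor22.CondP2 P l → Cor22.CondP5 P l → Cor22.CondP6 P l →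
      6 * ((1 + 20 * (Cor22.dmod P : ℝ) / l) * (P.logDiff + Cor22.logCondAvoid P {2, l}))
          + 120 * (2 ^ 12 * 3 ^ 3 * 5 * (Cor22.dmod P : ℝ) * l) < Cor22.logQAvoid P {2, l} →
      ∀ T : Cor22.ThetaVolumeDatumAt P l,
        (letI := T.instFieldF; letI := T.instNumberFieldF; letI := T.instAlgebraF; letI := T.instFieldK
         letI := T.instNumberFieldK; letI := T.instAlgebraK; letI := T.instFieldFbar; letI := T.instAlgebraFbar
         letI := T.instAlgebraKFbar; letI := T.instIsElliptic
         ¬ (∀ p ∈ T.I.supportPrimes, ∀ v w : placesOver (fieldOfModuli T.E) p,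
            (Summit.ABC.IUTFork.DHData.ofInput T.I).logQloc p v = (Summit.ABC.IUTFork.DHData.ofInput T.I).logQloc p w)) →
        T.HullEstimateOf
          (((l : ℝ) + 1) / 4 *
            ((1 + 12 * (Cor22.dmod P : ℝ) / l) * (P.logDiff + Cor22.logCondAvoid P {2, l})
              + 2 * Real.log l + 52
              + 20 / 3 * Real.log (((2 ^ 12 * 3 ^ 3 * 5 * Cor22.dmod P : ℕ) : ℝ) * (l : ℝ))
                * (Nat.primeCounting (2 ^ 12 * 3 ^ 3 * 5 * Cor22.dmod P * l) : ℝ)))) :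
    ABCCompactlyBoundedWith {2} (1 / μ₀) :=
  Cor22.abcCompactlyBoundedWith_two_of_thm110LegendreWith_one_div hμ₀ hμ₁
    (thm110LegendreWith_of_cor312Slack_mu_content_hregC μ₀ hμ₀ hμ₁ ε h312C hMuC hregC)

/-- **R19 SHAPE (a) — `ABCExpOn_farFromCusps_of_cor312Slack_mu_content_hregC`: abc WITH EXPONENT `1/μ₀` ON EVERY FAR-FROM-CUSPS FAMILY, TRANSFER-FREE.**
[NUMΣ-C] · [MU-C] · [CONE-C] on the content locus (`0 < μ₀ ≤ 1`) ⟹ for every `0 < ρ ≤ 1/2`: `∀ ε > 0, ∃ C = C(ρ, ε) > 0`, `c < C·rad(abc)^{(1/μ₀)·(1+ε)}` for all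
abc triples whose point `λ = a/c` is `ρ`-far from the cusps at `∞` and `2` (`min(a, b) > ρ·c ∧ 2^{v₂(abc)} ≤ 1/ρ`, abc-iut-rh-typ-7's triples dictionary) —
`GenEll.ABCWithExponentOn {P | P.FarFromCusps {2} ρ} (1/μ₀)`, F1 §4 (no Belyi map; no single such family contains all triples — R19). `μ₀ = 1`: exponent
`1 + ε` on these families (the record chain gives it on ALL triples, p481829 §4). CONDITIONAL; nothing asserted about the hypotheses; no side taken.
[cite: Mochizuki2012, IUTchIV Cor. 2.2–2.3 pp. 41–55] [cite: MochizukiGenEll2010, Thm 2.1 p.12] [cite: Mochizuki2012, IUTchIII Cor. 3.12 p. 174]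
[claim: Mochizuki2012, status: disputed] -/
theorem ABCExpOn_farFromCusps_of_cor312Slack_mu_content_hregC (μ₀ : ℝ) (hμ₀ : 0 < μ₀) (hμ₁ : μ₀ ≤ 1)
    (ε : ∀ (P : NFPoint) (l : ℕ), Cor22.ThetaVolumeDatumAt P l → ℝ)
    (h312C : ∀ P : NFPoint, P ∈ UP → ∀ l : ℕ, l.Prime → 5 ≤ l →
      Cor22.AdmitsCore P → Cor22.CondP2 P l → Cor22.CondP5 P l → Cor22.CondP6 P l →
      6 * ((1 + 20 * (Cor22.dmod P : ℝ) / l) * (P.logDiff + Cor22.logCondAvoid P {2, l}))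
          + 120 * (2 ^ 12 * 3 ^ 3 * 5 * (Cor22.dmod P : ℝ) * l) < Cor22.logQAvoid P {2, l} →
      ∀ T : Cor22.ThetaVolumeDatumAt P l, T.negAbsLogQ ≤ T.negLogTheta + ε P l T)
    (hMuC : ∀ P : NFPoint, P ∈ UP → ∀ l : ℕ, l.Prime → 5 ≤ l →
      Cor22.AdmitsCore P → Cor22.CondP2 P l → Cor22.CondP5 P l → Cor22.CondP6 P l →
      6 * ((1 + 20 * (Cor22.dmod P : ℝ) / l) * (P.logDiff + Cor22.logCondAvoid P {2, l}))
          + 120 * (2 ^ 12 * 3 ^ 3 * 5 * (Cor22.dmod P : ℝ) * l) < Cor22.logQAvoid P {2, l} →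
      ∀ T : Cor22.ThetaVolumeDatumAt P l, Repair.RH.OffSigma.OffSigmaTolerance (1 - μ₀) (SigmaMass.tol P l) T (ε P l T))
    (hregC : ∀ P : NFPoint, P ∈ UP → ∀ l : ℕ, l.Prime → 5 ≤ l →
      Cor22.AdmitsCore P → Cor22.CondP2 P l → Cor22.CondP5 P l → Cor22.CondP6 P l →
      6 * ((1 + 20 * (Cor22.dmod P : ℝ) / l) * (P.logDiff + Cor22.logCondAvoid P {2, l}))
          + 120 * (2 ^ 12 * 3 ^ 3 * 5 * (Cor22.dmod P : ℝ) * l) < Cor22.logQAvoid P {2, l} →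
      ∀ T : Cor22.ThetaVolumeDatumAt P l,
        (letI := T.instFieldF; letI := T.instNumberFieldF; letI := T.instAlgebraF; letI := T.instFieldK
         letI := T.instNumberFieldK; letI := T.instAlgebraK; letI := T.instFieldFbar; letI := T.instAlgebraFbar
         letI := T.instAlgebraKFbar; letI := T.instIsElliptic
         ¬ (∀ p ∈ T.I.supportPrimes, ∀ v w : placesOver (fieldOfModuli T.E) p,
            (Summit.ABC.IUTFork.DHData.ofInput T.I).logQloc p v = (Summit.ABC.IUTFork.DHData.ofInput T.I).logQloc p w)) →
        T.HullEstimateOf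
          (((l : ℝ) + 1) / 4 *
            ((1 + 12 * (Cor22.dmod P : ℝ) / l) * (P.logDiff + Cor22.logCondAvoid P {2, l})
              + 2 * Real.log l + 52
              + 20 / 3 * Real.log (((2 ^ 12 * 3 ^ 3 * 5 * Cor22.dmod P : ℕ) : ℝ) * (l : ℝ))
                * (Nat.primeCounting (2 ^ 12 * 3 ^ 3 * 5 * Cor22.dmod P * l) : ℝ)))) {ρ : ℝ} (h0 : 0 < ρ) (h2 : ρ ≤ 1 / 2) :
    ABCWithExponentOn {P : NFPoint | P.FarFromCusps {2} ρ} (1 / μ₀) :=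
  Cor22.abcExpOn_farFromCusps_of_thm110LegendreWith_one_div hμ₀ hμ₁
    (thm110LegendreWith_of_cor312Slack_mu_content_hregC μ₀ hμ₀ hμ₁ ε h312C hMuC hregC) h0 h2

/-- **R19 SHAPE (b) — `ABCExp_of_cor312Slack_mu_content_hregC`: abc WITH EXPONENT `1/μ₀` FOR ALL TRIPLES, UNDER THE NAMED OPEN HYPOTHESIS.**
[NUMΣ-C] · [MU-C] · [CONE-C] on the content locus (`0 < μ₀ ≤ 1`) AND `(hGenEllΛ : GenEll.GenEll_thm21_primesWith (1/μ₀))` — the SHAPE «(ii)_Λ ⇒ (i)_Λ|_{ℙ¹}»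
of [GenEll] Thm. 2.1 at `Λ = 1/μ₀`, which is **NOT in print and NOT in reach of the printed noncritical-Belyi mechanism for any `Λ > 1`** (exponent rigidity,
abc-iut-rh-typ-7 `GenEll.belyi_slope_not_pos`, rh-lead R19); OPEN; asserted by nobody; NEVER to be read as «discharged when a port lands» — ⟹
`GenEll.ABCWithExponent (1/μ₀)`: `∀ ε > 0, ∃ C > 0, c < C·rad(abc)^{(1/μ₀)(1+ε)}` for every abc triple. At `μ₀ = 1` the extra hypothesis IS the tree's PROVED
`GenEll_thm21_primes` (`genEll_thm21_primesWith_one_iff`, `GenEll_thm21_primes_holds`) and the conclusion is abc itself (`abcWithExponent_one_iff`; p481829 §4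
`ABC_of_cor312Slack_mu_one_content_hregC`). CONDITIONAL; nothing asserted about any hypothesis; no side taken.
[cite: Mochizuki2012, IUTchIV Cor. 2.2–2.3 pp. 41–55] [cite: MochizukiGenEll2010, Thm 2.1 p.11] [cite: Mochizuki2012, IUTchIII Cor. 3.12 p. 174]
[claim: Mochizuki2012, status: disputed] -/
theorem ABCExp_of_cor312Slack_mu_content_hregC (μ₀ : ℝ) (hμ₀ : 0 < μ₀) (hμ₁ : μ₀ ≤ 1)
    (ε : ∀ (P : NFPoint) (l : ℕ), Cor22.ThetaVolumeDatumAt P l → ℝ)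
    (h312C : ∀ P : NFPoint, P ∈ UP → ∀ l : ℕ, l.Prime → 5 ≤ l →
      Cor22.AdmitsCore P → Cor22.CondP2 P l → Cor22.CondP5 P l → Cor22.CondP6 P l →
      6 * ((1 + 20 * (Cor22.dmod P : ℝ) / l) * (P.logDiff + Cor22.logCondAvoid P {2, l}))
          + 120 * (2 ^ 12 * 3 ^ 3 * 5 * (Cor22.dmod P : ℝ) * l) < Cor22.logQAvoid P {2, l} →
      ∀ T : Cor22.ThetaVolumeDatumAt P l, T.negAbsLogQ ≤ T.negLogTheta + ε P l T)
    (hMuC : ∀ P : NFPoint, P ∈ UP → ∀ l : ℕ, l.Prime → 5 ≤ l →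
      Cor22.AdmitsCore P → Cor22.CondP2 P l → Cor22.CondP5 P l → Cor22.CondP6 P l →
      6 * ((1 + 20 * (Cor22.dmod P : ℝ) / l) * (P.logDiff + Cor22.logCondAvoid P {2, l}))
          + 120 * (2 ^ 12 * 3 ^ 3 * 5 * (Cor22.dmod P : ℝ) * l) < Cor22.logQAvoid P {2, l} →
      ∀ T : Cor22.ThetaVolumeDatumAt P l, Repair.RH.OffSigma.OffSigmaTolerance (1 - μ₀) (SigmaMass.tol P l) T (ε P l T))
    (hregC : ∀ P : NFPoint, P ∈ UP → ∀ l : ℕ, l.Prime → 5 ≤ l →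
      Cor22.AdmitsCore P → Cor22.CondP2 P l → Cor22.CondP5 P l → Cor22.CondP6 P l →
      6 * ((1 + 20 * (Cor22.dmod P : ℝ) / l) * (P.logDiff + Cor22.logCondAvoid P {2, l}))
          + 120 * (2 ^ 12 * 3 ^ 3 * 5 * (Cor22.dmod P : ℝ) * l) < Cor22.logQAvoid P {2, l} →
      ∀ T : Cor22.ThetaVolumeDatumAt P l,
        (letI := T.instFieldF; letI := T.instNumberFieldF; letI := T.instAlgebraF; letI := T.instFieldK
         letI := T.instNumberFieldK; letI := T.instAlgebraK; letI := T.instFieldFbar; letI := T.instAlgebraFbar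
         letI := T.instAlgebraKFbar; letI := T.instIsElliptic
         ¬ (∀ p ∈ T.I.supportPrimes, ∀ v w : placesOver (fieldOfModuli T.E) p,
            (Summit.ABC.IUTFork.DHData.ofInput T.I).logQloc p v = (Summit.ABC.IUTFork.DHData.ofInput T.I).logQloc p w)) →
        T.HullEstimateOf
          (((l : ℝ) + 1) / 4 *
            ((1 + 12 * (Cor22.dmod P : ℝ) / l) * (P.logDiff + Cor22.logCondAvoid P {2, l})
              + 2 * Real.log l + 52
              + 20 / 3 * Real.log (((2 ^ 12 * 3 ^ 3 * 5 * Cor22.dmod P : ℕ) : ℝ) * (l : ℝ))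
                * (Nat.primeCounting (2 ^ 12 * 3 ^ 3 * 5 * Cor22.dmod P * l) : ℝ))))
    -- [GENELL-Λ] the With-shape of [GenEll] Thm. 2.1 at Λ = 1/μ₀ — NOT in print, NOT in reach of the printed Belyi mechanism (R19); OPEN; a hypothesis
    (hGenEllΛ : GenEll_thm21_primesWith (1 / μ₀)) :
    ABCWithExponent (1 / μ₀) :=
  Cor22.abcExp_of_thm110LegendreWith_one_div hμ₀ hμ₁
    (thm110LegendreWith_of_cor312Slack_mu_content_hregC μ₀ hμ₀ hμ₁ ε h312C hMuC hregC) hGenEllΛ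

/-! ## §4 `μ₀ = 1`: the `With`-chain returns the SUMMIT statement, by name -/

/-- **`GenEll.ABCWithExponent 1 ↔ ABC`** (the summit statement `_root_.ABC` := Masser–Oesterlé, strong form): abc-iut-rh-typ-7's Literature-side regression
`abcWithExponent_one_iff` targets the displayed sentence, which IS `ABC` by `δ` (`ABC_iff` is `Iff.rfl`); this is the Summits-side corollary by name.
[cite: MochizukiGenEll2010, Thm 2.1 p.11] [cite: BombieriGubler2006, Conj. 12.2.2] -/
theorem abcWithExponent_one_iff_ABC : ABCWithExponent 1 ↔ _root_.ABC :=
  abcWithExponent_one_iff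

-- **FULL-CIRCLE REGRESSION AT `μ₀ = 1` THROUGH THE `With`-CHAIN**: [NUMΣ-C] · [MU-C]₁ (`OffSigmaTolerance (1 − 1) Tol T ε`, i.e. p476943's [TOL-C]) · [CONE-C]
-- ⟹ `ABC` via `ABCExp_of_cor312Slack_mu_content_hregC` at `μ₀ = 1`, the extra hypothesis `GenEll_thm21_primesWith (1/1)` being DISCHARGED by the tree's PROVED
-- `GenEll_thm21_primes_holds` (`genEll_thm21_primesWith_one_iff`) — so at `Λ = 1` the whole chain F4½ ∘ F3/F4 ∘ F1 reproduces the record end (p481829 §4 /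
-- p476943 `ABC_of_cor312Slack_content_hregC` give the same `ABC` directly). CONDITIONAL on the three content-cut binders; no side taken.
-- [cite: Mochizuki2012, IUTchIV Cor. 2.2–2.3 pp. 41–55] [cite: Mochizuki2012, IUTchIII Cor. 3.12 p. 174] [claim: Mochizuki2012, status: disputed]
-- Kernel cross-check ONLY (an `example`, not re-declared: the statement is p481829 §4 `ABC_of_cor312Slack_mu_one_content_hregC` verbatim).
example
    (ε : ∀ (P : NFPoint) (l : ℕ), Cor22.ThetaVolumeDatumAt P l → ℝ)
    (h312C : ∀ P : NFPoint, P ∈ UP → ∀ l : ℕ, l.Prime → 5 ≤ l →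
      Cor22.AdmitsCore P → Cor22.CondP2 P l → Cor22.CondP5 P l → Cor22.CondP6 P l →
      6 * ((1 + 20 * (Cor22.dmod P : ℝ) / l) * (P.logDiff + Cor22.logCondAvoid P {2, l}))
          + 120 * (2 ^ 12 * 3 ^ 3 * 5 * (Cor22.dmod P : ℝ) * l) < Cor22.logQAvoid P {2, l} →
      ∀ T : Cor22.ThetaVolumeDatumAt P l, T.negAbsLogQ ≤ T.negLogTheta + ε P l T)
    (hMuC : ∀ P : NFPoint, P ∈ UP → ∀ l : ℕ, l.Prime → 5 ≤ l →
      Cor22.AdmitsCore P → Cor22.CondP2 P l → Cor22.CondP5 P l → Cor22.CondP6 P l →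
      6 * ((1 + 20 * (Cor22.dmod P : ℝ) / l) * (P.logDiff + Cor22.logCondAvoid P {2, l}))
          + 120 * (2 ^ 12 * 3 ^ 3 * 5 * (Cor22.dmod P : ℝ) * l) < Cor22.logQAvoid P {2, l} →
      ∀ T : Cor22.ThetaVolumeDatumAt P l, Repair.RH.OffSigma.OffSigmaTolerance (1 - 1) (SigmaMass.tol P l) T (ε P l T))
    (hregC : ∀ P : NFPoint, P ∈ UP → ∀ l : ℕ, l.Prime → 5 ≤ l →
      Cor22.AdmitsCore P → Cor22.CondP2 P l → Cor22.CondP5 P l → Cor22.CondP6 P l →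
      6 * ((1 + 20 * (Cor22.dmod P : ℝ) / l) * (P.logDiff + Cor22.logCondAvoid P {2, l}))
          + 120 * (2 ^ 12 * 3 ^ 3 * 5 * (Cor22.dmod P : ℝ) * l) < Cor22.logQAvoid P {2, l} →
      ∀ T : Cor22.ThetaVolumeDatumAt P l,
        (letI := T.instFieldF; letI := T.instNumberFieldF; letI := T.instAlgebraF; letI := T.instFieldK
         letI := T.instNumberFieldK; letI := T.instAlgebraK; letI := T.instFieldFbar; letI := T.instAlgebraFbar
         letI := T.instAlgebraKFbar; letI := T.instIsElliptic
         ¬ (∀ p ∈ T.I.supportPrimes, ∀ v w : placesOver (fieldOfModuli T.E) p,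
            (Summit.ABC.IUTFork.DHData.ofInput T.I).logQloc p v = (Summit.ABC.IUTFork.DHData.ofInput T.I).logQloc p w)) →
        T.HullEstimateOf
          (((l : ℝ) + 1) / 4 *
            ((1 + 12 * (Cor22.dmod P : ℝ) / l) * (P.logDiff + Cor22.logCondAvoid P {2, l})
              + 2 * Real.log l + 52
              + 20 / 3 * Real.log (((2 ^ 12 * 3 ^ 3 * 5 * Cor22.dmod P : ℕ) : ℝ) * (l : ℝ))
                * (Nat.primeCounting (2 ^ 12 * 3 ^ 3 * 5 * Cor22.dmod P * l) : ℝ)))) :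
    _root_.ABC := by
  have h := ABCExp_of_cor312Slack_mu_content_hregC 1 one_pos le_rfl ε h312C hMuC hregC
    (by rw [div_one]; exact genEll_thm21_primesWith_one_iff.2 GenEll_thm21_primes_holds)
  rw [div_one] at h
  exact abcWithExponent_one_iff_ABC.1 h

end Summit.ABC.IUTFork.Conditional.Cor312Slack

end
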